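import Summits.BirchSwinnertonDyer.Rank2.Family81517MinimalOrdinary
import HarnessLib

/-!
# Certified partners of Greenberg type A, I₁″: the full-`2`-torsion neighbour `W″_i` for `D ≡ 1 (mod 4)` (cell `bsd-rank2`)

Cell `bsd-rank2` (D-0036), seat `bsd-rank2-lit` GEN 18, stub `stub_partnerCF` (E1M line `cfsplit`), TYPE A, branch
`D = 4i + 1`: the CF-habitat neighbour `W″_i = ⟨1, −3i−13, 0, 36i+9, 0⟩ : y² + xy = x³ − (3i+13)x² + 9(4i+1)x` of the
partner `W′_i` of `Rank2/CertifiedPartnerTypeAModelOne.lean` — the minimal model (`x = 16x′`, `y = 64y′ + 32x′`) of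
`Y² = X(X − 192)(X − 12D)`, the quotient of `Y² = X(X² + 6(D+16)X + 9(D−16)²)` by `⟨(0,0)⟩`.
* `Δ(W″_i) = 729·(4i+1)²·(4i−15)²` (odd), `c₄(W″_i) = 9·(16i² − 56i + 241)`; Bezout:
  `(16i²−56i+241) − (4i+1)(4i−15) = 256`, `9 ∤ 16i²−56i+241` ⇒ GLOBAL MINIMAL MODEL, elliptic, GOOD ORDINARY at `2`
  (reduction `y² + xy = x³ + (ī+1)x² + x`). The isogeny `W″_i ~ W′_i` and the `2`-torsion bookkeeping are in
  `Rank2/CertifiedPartnerTypeANeighbourIsogeny.lean` / `Rank2/CertifiedPartnerTypeA.lean`.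

PARTITION: none — r_an ≥ 2, summit axis S0; TWIN (D-0056): n/a. B1: explicit-model algebra (discriminant,
`c₄`, Silverman's minimality criterion, reduction mod `2`); no `L`-function, no Selmer group, no S0 motion.
No named fact, no `sorry`. Templates: `Rank2/CertifiedPartnerTypeBModel.lean`, `Rank2/Family81517MinimalOrdinary.lean`.
-/

namespace Summit.BirchSwinnertonDyer.Rank2

open _root_.WeierstrassCurve
open Literature.NumberTheory.EllipticCurves
open Literature.NumberTheory.EllipticCurves.Rank1Residual.X11RankOneCertificates

section NeighbourTypeAModelOne

/-! ### The integer model, its discriminant and `c₄` -/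

/-- The discriminant of the integer model. [folklore] -/
theorem neighbourAOneInt_Δ (i : ℤ) :
    (⟨1, -3 * i - 13, 0, 36 * i + 9, 0⟩ : WeierstrassCurve ℤ).Δ =
      729 * (4 * i + 1) ^ 2 * (4 * i - 15) ^ 2 := by
  simp only [WeierstrassCurve.Δ, WeierstrassCurve.b₂, WeierstrassCurve.b₄, WeierstrassCurve.b₆,
    WeierstrassCurve.b₈]
  ring

/-- The certificate schema's `discOf` of the integer model. [folklore] -/
theorem discOf_neighbourAOne (i : ℤ) :
    discOf [1, -3 * i - 13, 0, 36 * i + 9, 0] = 729 * (4 * i + 1) ^ 2 * (4 * i - 15) ^ 2 := by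
  rw [← neighbourAOneInt_Δ]
  simp only [discOf, invariants, WeierstrassCurve.Δ, WeierstrassCurve.b₂, WeierstrassCurve.b₄,
    WeierstrassCurve.b₆, WeierstrassCurve.b₈]
  ring

/-- The certificate schema's `c4Of` of the integer model. [folklore] -/
theorem c4Of_neighbourAOne (i : ℤ) :
    c4Of [1, -3 * i - 13, 0, 36 * i + 9, 0] = 9 * (16 * i ^ 2 - 56 * i + 241) := by
  simp only [c4Of, invariants]
  ring

/-- The rational model with all coefficients as integer casts. [folklore] -/
theorem neighbourAOne_model_eq_intCast (i : ℤ) :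
    (⟨1, ((-3 * i - 13 : ℤ) : ℚ), ((0 : ℤ) : ℚ), ((36 * i + 9 : ℤ) : ℚ), ((0 : ℤ) : ℚ)⟩ :
      WeierstrassCurve ℚ) =
      ⟨((1 : ℤ) : ℚ), ((-3 * i - 13 : ℤ) : ℚ), ((0 : ℤ) : ℚ), ((36 * i + 9 : ℤ) : ℚ), ((0 : ℤ) : ℚ)⟩ := by
  ext <;> simp

/-- The rational model is the base change of the integer model. [folklore] -/
theorem neighbourAOneInt_baseChange (i : ℤ) :
    (⟨1, -3 * i - 13, 0, 36 * i + 9, 0⟩ : WeierstrassCurve ℤ).baseChange ℚ =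
      (⟨1, ((-3 * i - 13 : ℤ) : ℚ), ((0 : ℤ) : ℚ), ((36 * i + 9 : ℤ) : ℚ), ((0 : ℤ) : ℚ)⟩ :
      WeierstrassCurve ℚ) := by
  rw [baseChange_int_eq_map]
  ext <;> simp [WeierstrassCurve.map]

/-- The discriminant of the rational model. [folklore] -/
theorem neighbourAOne_Δ (i : ℤ) :
    (⟨1, ((-3 * i - 13 : ℤ) : ℚ), ((0 : ℤ) : ℚ), ((36 * i + 9 : ℤ) : ℚ), ((0 : ℤ) : ℚ)⟩ :
      WeierstrassCurve ℚ).Δ =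
      729 * (4 * i + 1) ^ 2 * (4 * i - 15) ^ 2 := by
  simp only [WeierstrassCurve.Δ, WeierstrassCurve.b₂, WeierstrassCurve.b₄, WeierstrassCurve.b₆,
    WeierstrassCurve.b₈]
  push_cast
  ring

/-! ### Parities -/

/-- The discriminant is odd. [folklore] -/
theorem odd_Δ_neighbourAOne (i : ℤ) : Odd (729 * (4 * i + 1) ^ 2 * (4 * i - 15) ^ 2 : ℤ) := by
  have h729 : Odd (729 : ℤ) := by decide
  have h1 : Odd (4 * i + 1 : ℤ) := ⟨2 * i, by ring⟩
  have h15 : Odd (4 * i - 15 : ℤ) := ⟨2 * i - 8, by ring⟩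
  exact (h729.mul h1.pow).mul h15.pow

/-- The discriminant is nonzero. [folklore] -/
theorem Δ_neighbourAOne_ne_zero (i : ℤ) : (729 * (4 * i + 1) ^ 2 * (4 * i - 15) ^ 2 : ℤ) ≠ 0 := by
  intro h
  have := Int.odd_iff.mp (odd_Δ_neighbourAOne i)
  rw [h] at this
  norm_num at this

/-! ### Silverman's criterion: no prime `q` with `q¹² ∣ Δ` and `q⁴ ∣ c₄` -/

/-- `9 ∤ 16i² − 56i + 241` (`≡ i² + i + 1 (mod 3)`, and `≡ 3 (mod 9)` when `i ≡ 1 (mod 3)`). [folklore] -/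
theorem not_nine_dvd_neighbourAOne_c₄ (i : ℤ) : ¬ (9 : ℤ) ∣ 16 * i ^ 2 - 56 * i + 241 := by
  intro h9
  have h3 : (3 : ℤ) ∣ 16 * i ^ 2 - 56 * i + 241 := dvd_trans ⟨3, by norm_num⟩ h9
  obtain ⟨m, hm⟩ : ∃ m : ℤ, i = 3 * m + i % 3 := ⟨i / 3, by omega⟩
  rcases (by omega : i % 3 = 0 ∨ i % 3 = 1 ∨ i % 3 = 2) with h | h | h <;> rw [h] at hm
  · rw [hm, show (16 * (3 * m + 0) ^ 2 - 56 * (3 * m + 0) + 241 : ℤ) =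
      3 * (48 * m ^ 2 - 56 * m + 80) + 1 by ring] at h3
    have := (dvd_add_right (Dvd.intro _ rfl)).mp h3
    omega
  · rw [hm, show (16 * (3 * m + 1) ^ 2 - 56 * (3 * m + 1) + 241 : ℤ) =
      9 * (16 * m ^ 2 - 8 * m + 22) + 3 by ring] at h9
    have := (dvd_add_right (Dvd.intro _ rfl)).mp h9
    omega
  · rw [hm, show (16 * (3 * m + 2) ^ 2 - 56 * (3 * m + 2) + 241 : ℤ) =
      3 * (48 * m ^ 2 + 8 * m + 64) + 1 by ring] at h3
    have := (dvd_add_right (Dvd.intro _ rfl)).mp h3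
    omega

/-- **No prime `q` has `q¹² ∣ Δ` and `q⁴ ∣ c₄`** (Bezout certificates in the docstring of the file). [folklore] -/
theorem not_pow_dvd_Δ_and_c₄_neighbourAOne (i : ℤ) (q : ℕ) (hq : q.Prime) :
    ¬ ((q : ℤ) ^ 12 ∣ 729 * (4 * i + 1) ^ 2 * (4 * i - 15) ^ 2 ∧
        (q : ℤ) ^ 4 ∣ 9 * (16 * i ^ 2 - 56 * i + 241)) := by
  rintro ⟨h12, h4⟩
  have hqp : Prime (q : ℤ) := Nat.prime_iff_prime_int.mp hq
  have hq1 : (q : ℤ) ∣ 729 * (4 * i + 1) ^ 2 * (4 * i - 15) ^ 2 :=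
    dvd_trans (dvd_pow_self (q : ℤ) (by norm_num)) h12
  have hq2 : (q : ℤ) ∣ 9 * (16 * i ^ 2 - 56 * i + 241) :=
    dvd_trans (dvd_pow_self (q : ℤ) (by norm_num)) h4
  by_cases hq3 : q = 3
  · subst hq3
    obtain ⟨c, hc⟩ := h4
    push_cast at hc
    exact not_nine_dvd_neighbourAOne_c₄ i ⟨c, by linarith⟩
  · have hq3Z : ¬ (q : ℤ) ∣ 3 := by
      intro h
      have hq3' : q ∣ 3 := by exact_mod_cast h
      rcases (Nat.dvd_prime Nat.prime_three).mp hq3' with h1 | h1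
      · exact hq.one_lt.ne' h1
      · exact hq3 h1
    have hq9 : ¬ (q : ℤ) ∣ 9 := fun h ↦ hq3Z (hqp.dvd_of_dvd_pow (by norm_num; exact h : (q : ℤ) ∣ 3 ^ 2))
    have hq729 : ¬ (q : ℤ) ∣ 729 := fun h ↦
      hq3Z (hqp.dvd_of_dvd_pow (by norm_num; exact h : (q : ℤ) ∣ 3 ^ 6))
    have hf : (q : ℤ) ∣ 16 * i ^ 2 - 56 * i + 241 := (hqp.dvd_or_dvd hq2).resolve_left hq9
    have hfodd : ¬ (2 : ℤ) ∣ 16 * i ^ 2 - 56 * i + 241 :=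
      Int.two_dvd_ne_zero.mpr (Int.odd_iff.mp ⟨8 * i ^ 2 - 28 * i + 120, by ring⟩)
    have hq2' : ¬ (q : ℤ) ∣ 2 := by
      intro h
      have hq2'' : q ∣ 2 := by exact_mod_cast h
      rcases (Nat.dvd_prime Nat.prime_two).mp hq2'' with h1 | h1
      · exact hq.one_lt.ne' h1
      · subst h1; exact hfodd (by exact_mod_cast hf)
    have hΔ : (q : ℤ) ∣ (4 * i + 1) ^ 2 * (4 * i - 15) ^ 2 := by
      rw [mul_assoc] at hq1
      exact (hqp.dvd_or_dvd hq1).resolve_left hq729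
    rcases hqp.dvd_or_dvd hΔ with h1 | h15
    · have h1' : (q : ℤ) ∣ 4 * i + 1 := hqp.dvd_of_dvd_pow h1
      have hk : (q : ℤ) ∣ (16 * i ^ 2 - 56 * i + 241) - (4 * i + 1) * (4 * i - 15) :=
        dvd_sub hf (dvd_mul_of_dvd_left h1' _)
      rw [show ((16 * i ^ 2 - 56 * i + 241) - (4 * i + 1) * (4 * i - 15) : ℤ) = 2 ^ 8 by ring] at hk
      exact hq2' (hqp.dvd_of_dvd_pow hk)
    · have h15' : (q : ℤ) ∣ 4 * i - 15 := hqp.dvd_of_dvd_pow h15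
      have hk : (q : ℤ) ∣ (16 * i ^ 2 - 56 * i + 241) - (4 * i - 15) * (4 * i + 1) :=
        dvd_sub hf (dvd_mul_of_dvd_left h15' _)
      rw [show ((16 * i ^ 2 - 56 * i + 241) - (4 * i - 15) * (4 * i + 1) : ℤ) = 2 ^ 8 by ring] at hk
      exact hq2' (hqp.dvd_of_dvd_pow hk)

/-! ### Global minimality, the integral model, the minimal discriminant, ellipticity -/

/-- **The model is a global minimal model.** [folklore: Silverman AEC VII.1 Remark 1.1, VIII.8] -/
theorem isGloballyMinimal_neighbourAOne (i : ℤ) :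
    (⟨1, ((-3 * i - 13 : ℤ) : ℚ), ((0 : ℤ) : ℚ), ((36 * i + 9 : ℤ) : ℚ), ((0 : ℤ) : ℚ)⟩ :
      WeierstrassCurve ℚ).IsGloballyMinimal := by
  rw [neighbourAOne_model_eq_intCast]
  refine isGloballyMinimal_of_int_criterion _ _ _ _ _ fun q hq hboth => ?_
  obtain ⟨h12, h4⟩ := hboth
  rw [discOf_neighbourAOne] at h12
  rw [c4Of_neighbourAOne] at h4
  exact not_pow_dvd_Δ_and_c₄_neighbourAOne i q hq ⟨h12, h4⟩

/-- The tree's integral model of the rational model is the integer model itself. [folklore] -/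
theorem integralModelInt_neighbourAOne (i : ℤ) :
    haveI := isGloballyMinimal_neighbourAOne i
    integralModelInt (⟨1, ((-3 * i - 13 : ℤ) : ℚ), ((0 : ℤ) : ℚ), ((36 * i + 9 : ℤ) : ℚ), ((0 : ℤ) : ℚ)⟩ :
      WeierstrassCurve ℚ) = ⟨1, -3 * i - 13, 0, 36 * i + 9, 0⟩ := by
  haveI := isGloballyMinimal_neighbourAOne i
  have key : ∀ (X : WeierstrassCurve ℚ) [X.IsGloballyMinimal],
      (⟨1, -3 * i - 13, 0, 36 * i + 9, 0⟩ : WeierstrassCurve ℤ).baseChange ℚ = X →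
        integralModelInt X = ⟨1, -3 * i - 13, 0, 36 * i + 9, 0⟩ := by
    rintro X _ rfl
    exact integralModelInt_baseChange_int _
  exact key _ (neighbourAOneInt_baseChange i)

/-- The minimal discriminant. [folklore] -/
theorem minimalDiscriminantInt_neighbourAOne (i : ℤ) :
    haveI := isGloballyMinimal_neighbourAOne i
    minimalDiscriminantInt (⟨1, ((-3 * i - 13 : ℤ) : ℚ), ((0 : ℤ) : ℚ), ((36 * i + 9 : ℤ) : ℚ), ((0 : ℤ) : ℚ)⟩ :
      WeierstrassCurve ℚ) = 729 * (4 * i + 1) ^ 2 * (4 * i - 15) ^ 2 := by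
  rw [minimalDiscriminantInt, integralModelInt_neighbourAOne, neighbourAOneInt_Δ]

/-- The model is an elliptic curve (`Δ ≠ 0`). [folklore] -/
theorem isElliptic_neighbourAOne (i : ℤ) :
    (⟨1, ((-3 * i - 13 : ℤ) : ℚ), ((0 : ℤ) : ℚ), ((36 * i + 9 : ℤ) : ℚ), ((0 : ℤ) : ℚ)⟩ :
      WeierstrassCurve ℚ).IsElliptic := by
  refine ⟨isUnit_iff_ne_zero.mpr ?_⟩
  rw [neighbourAOne_Δ]
  exact_mod_cast Δ_neighbourAOne_ne_zero i

/-! ### Good ordinary reduction at `2` -/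

/-- **Good reduction at `2`** (`Δ` odd). [folklore: Silverman AEC VII.1 Remark 1.1] -/
theorem hasGoodReductionAtPrime_two_neighbourAOne (i : ℤ) :
    haveI := isGloballyMinimal_neighbourAOne i
    (⟨1, ((-3 * i - 13 : ℤ) : ℚ), ((0 : ℤ) : ℚ), ((36 * i + 9 : ℤ) : ℚ), ((0 : ℤ) : ℚ)⟩ :
      WeierstrassCurve ℚ).HasGoodReductionAtPrime 2 := by
  haveI := isGloballyMinimal_neighbourAOne i
  refine hasGoodReductionAtPrime_of_not_dvd _ 2 ?_
  rw [minimalDiscriminantInt_neighbourAOne]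
  exact_mod_cast Int.two_dvd_ne_zero.mpr (Int.odd_iff.mp (odd_Δ_neighbourAOne i))

/-- The reduction of the integer model modulo `2`. [folklore] -/
theorem neighbourAOneInt_map_zmod_two (i : ℤ) :
    (⟨1, -3 * i - 13, 0, 36 * i + 9, 0⟩ : WeierstrassCurve ℤ).map (Int.castRingHom (ZMod 2)) =
      ⟨1, (i : ZMod 2) + 1, 0, 1, 0⟩ := by
  have h2 : ((2 : ℤ) : ZMod 2) = 0 := by decide
  have ha₂ : ((-3 * i - 13 : ℤ) : ZMod 2) = (i : ZMod 2) + 1 := by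
    rw [show (-3 * i - 13 : ℤ) = 2 * (-2 * i - 7) + (i + 1) by ring, Int.cast_add, Int.cast_mul, h2,
      zero_mul, zero_add]; push_cast; ring
  have ha₃ : ((0 : ℤ) : ZMod 2) = 0 := by
    rw [show (0 : ℤ) = 2 * (0) + (0) by ring, Int.cast_add, Int.cast_mul, h2,
      zero_mul, zero_add]; push_cast; ring
  have ha₄ : ((36 * i + 9 : ℤ) : ZMod 2) = 1 := by
    rw [show (36 * i + 9 : ℤ) = 2 * (18 * i + 4) + (1) by ring, Int.cast_add, Int.cast_mul, h2,
      zero_mul, zero_add]; push_cast; ring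
  have ha₆ : ((0 : ℤ) : ZMod 2) = 0 := by
    rw [show (0 : ℤ) = 2 * (0) + (0) by ring, Int.cast_add, Int.cast_mul, h2,
      zero_mul, zero_add]; push_cast; ring
  ext
  · show (Int.castRingHom (ZMod 2)) 1 = 1
    rw [map_one]
  · show (Int.castRingHom (ZMod 2)) (-3 * i - 13) = (i : ZMod 2) + 1
    rw [eq_intCast, ha₂]
  · show (Int.castRingHom (ZMod 2)) (0) = 0
    rw [eq_intCast, ha₃]
  · show (Int.castRingHom (ZMod 2)) (36 * i + 9) = 1
    rw [eq_intCast, ha₄]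
  · show (Int.castRingHom (ZMod 2)) (0) = 0
    rw [eq_intCast, ha₆]

/-- **Ordinary at `2`**: the trace `3 − #W̃(𝔽₂) ∈ {1, −1}` is odd. [folklore] -/
theorem not_two_dvd_frobeniusTrace_neighbourAOne (i : ℤ) :
    haveI := isGloballyMinimal_neighbourAOne i
    ¬ ((2 : ℕ) : ℤ) ∣ frobeniusTrace (⟨1, ((-3 * i - 13 : ℤ) : ℚ), ((0 : ℤ) : ℚ), ((36 * i + 9 : ℤ) : ℚ), ((0 : ℤ) : ℚ)⟩ :
      WeierstrassCurve ℚ) 2 := by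
  haveI := isGloballyMinimal_neighbourAOne i
  rw [frobeniusTrace, reductionPointCount, integralModelInt_neighbourAOne, neighbourAOneInt_map_zmod_two]
  rcases natCard_point_F2_family81517 ((i : ZMod 2) + 1) with h | h <;> rw [h] <;> norm_num

/-- **Good ordinary at `2`** (for the minimality instance above). [folklore] -/
theorem isOrdinaryAt_two_neighbourAOne (i : ℤ) :
    @IsOrdinaryAt (⟨1, ((-3 * i - 13 : ℤ) : ℚ), ((0 : ℤ) : ℚ), ((36 * i + 9 : ℤ) : ℚ), ((0 : ℤ) : ℚ)⟩ :
      WeierstrassCurve ℚ)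
      (isGloballyMinimal_neighbourAOne i) 2 _ :=
  ⟨hasGoodReductionAtPrime_two_neighbourAOne i, not_two_dvd_frobeniusTrace_neighbourAOne i⟩

end NeighbourTypeAModelOne

end Summit.BirchSwinnertonDyer.Rank2
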